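import Summits.NavierStokesRegularity.FluidComputer.LevelReynoldsFloor
import Literature.Analysis.FluidPDE.DissipationWavenumber

/-!
# Fluid computer — the Λ-FRONTIER of a blow-up: unbounded, yet integrable (rung R2; pub-fluidc-lit gen 36)

HONEST FRAMING (cell `pub-fluidc`, verbatim): *low prior, high value-of-information experiment on Tao's
machine paradigm; NOT a claim that NS blows up.* Theorem side of the cell; nothing here is evidence of
blow-up.

The amplitude rung reads every run through its level Reynolds numbers `‖Δ̇_j u(t)‖_∞ / (ν 2^j)`; the
Cheskidov–Shvydkoy DISSIPATION WAVENUMBER `Λ_{c₀,ν}(u(t))` (tree: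
`Literature.Analysis.FluidPDE.dissipationWavenumber`, arXiv:1102.1944 §3) is the top dyadic level at which
that number still reaches the threshold `c₀` — the rung's FRONTIER. This file states the two things the
tree proves about the frontier of a would-be blow-up, in the cell's vocabulary (maximal smooth solutions,
Leray–Hopf from `u 0`, no slice-distribution bookkeeping in the hypotheses):

* `iSup_dissipationWavenumber_eq_top` — **the frontier is unbounded**: for every maximal smooth solution
  with finite lifespan `T`, Leray–Hopf from `u 0`, and every threshold `c₀` below the Cheskidov–Shvydkoy
  constant, `sup_{t ∈ (0,T)} Λ_{c₀,ν}(u(t)) = ∞` (the level-Reynolds floor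
  `LevelReynoldsFloor.level_amplitude_frequently_gt`, i.e. Cheskidov–Shvydkoy 2010 Lemma 3.2, read
  through `Literature.Analysis.FluidPDE.isSaturatedLevel_iff_le_lpBlockWeight`);
* `lintegral_dissipationWavenumber_lt_top` — **yet the frontier is integrable**: `∫₀ᵀ Λ_{c₀,ν}(u(t)) dt < ∞`
  for every Leray–Hopf solution (Cheskidov–Shvydkoy 2014 Lemma 4.1, tree
  `Literature.Analysis.FluidPDE.exists_lintegral_dissipationWavenumber_le`).

Cascade reading (dictionary, hedged): a blow-up organised in levels `k_n` with dwell times `T_n` at the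
frontier has `sup_n k_n = ∞` but `∑_n k_n T_n ≲ T + E(u₀)/(c₀² ν³) < ∞` — the printed gap between `L¹`
(a priori) and `L^{5/2}` (sufficient for regularity, Cheskidov–Shvydkoy 2014 Thm 3.1, not in the tree) is
where a machine would have to live.

## References

* A. Cheskidov, R. Shvydkoy, Arch. Ration. Mech. Anal. 195 (2010) 159–169, Lemma 3.2. [CheskidovShvydkoy2010]
* A. Cheskidov, R. Shvydkoy, J. Math. Fluid Mech. 16 (2014) 263–273 = arXiv:1102.1944, §3, Lemma 4.1.
  [CheskidovShvydkoy2011]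
-/

noncomputable section

open MeasureTheory Set Function Filter Topology TemperedDistribution
open scoped ENNReal NNReal SchwartzMap
open Literature.Analysis.FluidPDE Literature.Analysis.FunctionSpaces

namespace Summit.NavierStokesRegularity.FluidComputer.LambdaFrontier

/-- Every slice of a Leray–Hopf solution on `[0,T]` has a tempered distribution (it is in `L²`); a
measurable-in-nothing choice, used only to feed the distribution-level floor theorem. [folklore] -/
theorem exists_sliceDistribution {ν T : ℝ}
    {u : ℝ → EuclideanSpace ℝ (Fin 3) → EuclideanSpace ℝ (Fin 3)} (hLH : IsLerayHopfOn T ν 0 (u 0) u) :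
    ∃ U : ℝ → 𝓢'(EuclideanSpace ℝ (Fin 3), EuclideanSpace ℂ (Fin 3)),
      ∀ t ∈ Icc 0 T, IsDistributionOf (u t) (U t) := by
  classical
  refine ⟨fun t => if ht : t ∈ Icc 0 T then
      Lp.toTemperedDistribution ((memLp_complexify_comp (hLH.memLp t ht)).toLp _) else 0, fun t ht => ?_⟩
  simp only [dif_pos ht]
  exact isDistributionOf_toTemperedDistribution (hLH.memLp t ht)

/-- **The Λ-frontier of a blow-up is unbounded.** There is an absolute `c > 0` (the constant of
`LevelReynoldsFloor.level_amplitude_frequently_gt`, from Cheskidov–Shvydkoy 2010 Lemma 3.2) such that for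
every `ν > 0`, `T > 0`, every maximal smooth solution `(u, p)` of the unforced Navier–Stokes system on
`ℝ³ × [0,T)` (no classical continuation past `T`) which is Leray–Hopf from `u 0`, and every threshold
`c₀ < c`: `sup_{t ∈ (0,T)} Λ_{c₀,ν}(u(t)) = ∞` — at infinitely many dyadic levels some slice before `T` is
saturated. [cite: CheskidovShvydkoy2010, Lemma 3.2] -/
theorem iSup_dissipationWavenumber_eq_top :
    ∃ c : ℝ, 0 < c ∧ ∀ (ν T : ℝ), 0 < ν → 0 < T →
      ∀ (u : ℝ → EuclideanSpace ℝ (Fin 3) → EuclideanSpace ℝ (Fin 3))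
        (p : ℝ → EuclideanSpace ℝ (Fin 3) → ℝ),
      IsMaximalSmoothSolution ν 0 u p T → IsLerayHopfOn T ν 0 (u 0) u →
      ∀ c₀ : ℝ, c₀ < c → ⨆ t ∈ Ioo 0 T, dissipationWavenumber c₀ ν (u t) = ∞ := by
  obtain ⟨c, hc, H⟩ := LevelReynoldsFloor.level_amplitude_frequently_gt
  refine ⟨c, hc, fun ν T hν hT u p hmax hLH c₀ hc₀ => ?_⟩
  obtain ⟨U, hU⟩ := exists_sliceDistribution hLH
  have hfreq := H ν T hν hT u p U hmax hLH hU c₀ hc₀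
  -- every dyadic level `2^n` lies below the supremum
  have hpow : ∀ n : ℕ, (2 : ℝ≥0∞) ^ n ≤ ⨆ t ∈ Ioo 0 T, dissipationWavenumber c₀ ν (u t) := by
    intro n
    obtain ⟨j, hj, hnj⟩ := (hfreq.and_eventually (eventually_ge_atTop n)).exists
    obtain ⟨t, hjt⟩ := lt_iSup_iff.1 hj
    obtain ⟨ht, hlt⟩ := lt_iSup_iff.1 hjt
    have hv : MemLp (u t) 2 volume := hLH.memLp t (Ioo_subset_Icc_self ht)
    have hsat : IsSaturatedLevel c₀ ν (u t) j :=
      (isSaturatedLevel_iff_le_lpBlockWeight (hU t (Ioo_subset_Icc_self ht)) hv c₀ ν j).2 hlt.le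
    calc (2 : ℝ≥0∞) ^ n ≤ 2 ^ j := pow_le_pow_right₀ one_le_two hnj
      _ ≤ dissipationWavenumber c₀ ν (u t) := two_pow_le_dissipationWavenumber hsat
      _ ≤ ⨆ t ∈ Ioo 0 T, dissipationWavenumber c₀ ν (u t) :=
          le_iSup₂_of_le (f := fun t (_ : t ∈ Ioo 0 T) => dissipationWavenumber c₀ ν (u t)) t ht le_rfl
  refine ENNReal.eq_top_of_forall_nnreal_le fun r => ?_
  calc (r : ℝ≥0∞) ≤ (⌈r⌉₊ : ℕ) := by exact_mod_cast Nat.le_ceil r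
    _ ≤ ((2 ^ ⌈r⌉₊ : ℕ) : ℝ≥0∞) := by exact_mod_cast (Nat.lt_two_pow_self).le
    _ = (2 : ℝ≥0∞) ^ ⌈r⌉₊ := by push_cast; rfl
    _ ≤ ⨆ t ∈ Ioo 0 T, dissipationWavenumber c₀ ν (u t) := hpow _

/-- **Yet the Λ-frontier is integrable in time** (Cheskidov–Shvydkoy 2014, Lemma 4.1, for the cell's
Leray–Hopf-from-`u 0` solutions): for `c₀ > 0`, `ν > 0`, `T > 0`, `∫₀ᵀ Λ_{c₀,ν}(u(t)) dt < ∞`; quantitatively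
`≤ T + C E(u(0))/(c₀²ν³)` (`Literature.Analysis.FluidPDE.exists_lintegral_dissipationWavenumber_le`). [cite: CheskidovShvydkoy2011, Lemma 4.1] -/
theorem lintegral_dissipationWavenumber_lt_top {ν T c₀ : ℝ}
    {u : ℝ → EuclideanSpace ℝ (Fin 3) → EuclideanSpace ℝ (Fin 3)} (hLH : IsLerayHopfOn T ν 0 (u 0) u)
    (hc₀ : 0 < c₀) (hν : 0 < ν) (hT : 0 < T) :
    ∫⁻ t in Ioo 0 T, dissipationWavenumber c₀ ν (u t) < ∞ := by
  obtain ⟨C, hC⟩ := exists_lintegral_dissipationWavenumber_le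
  exact (hC c₀ ν T (u 0) u hc₀ hν hT hLH).trans_lt
    (ENNReal.add_lt_top.2 ⟨ENNReal.ofReal_lt_top, ENNReal.ofReal_lt_top⟩)

/-- **Both at once, for a maximal smooth solution with finite lifespan** (thresholds `0 < c₀ < c`): the
frontier `t ↦ Λ_{c₀,ν}(u(t))` is unbounded on `(0,T)` but has finite time integral — in cascade words the
levels visited are unbounded while `∑ k_n T_n < ∞`. [cite: CheskidovShvydkoy2011, Lemma 4.1] -/
theorem frontier_unbounded_and_integrable :
    ∃ c : ℝ, 0 < c ∧ ∀ (ν T : ℝ), 0 < ν → 0 < T →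
      ∀ (u : ℝ → EuclideanSpace ℝ (Fin 3) → EuclideanSpace ℝ (Fin 3))
        (p : ℝ → EuclideanSpace ℝ (Fin 3) → ℝ),
      IsMaximalSmoothSolution ν 0 u p T → IsLerayHopfOn T ν 0 (u 0) u →
      ∀ c₀ : ℝ, 0 < c₀ → c₀ < c →
        (⨆ t ∈ Ioo 0 T, dissipationWavenumber c₀ ν (u t)) = ∞ ∧
          ∫⁻ t in Ioo 0 T, dissipationWavenumber c₀ ν (u t) < ∞ := by
  obtain ⟨c, hc, H⟩ := iSup_dissipationWavenumber_eq_top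
  exact ⟨c, hc, fun ν T hν hT u p hmax hLH c₀ hc₀ hc₀c =>
    ⟨H ν T hν hT u p hmax hLH c₀ hc₀c, lintegral_dissipationWavenumber_lt_top hLH hc₀ hν hT⟩⟩

end Summit.NavierStokesRegularity.FluidComputer.LambdaFrontier

end
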